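import Summits.QuantumFields.BalabanUV.Beta.D1BFx.TorusZerothJunction
import Summits.QuantumFields.BalabanUV.Beta.D1BFx.MixedVarPackedHess

/-!
# `BalabanUV.Beta.D1BFx.TorusCoframeJets` — road «BF-x» for binder row D1, slot (K), X₃(ii) ROUTE T, owner row **«TB4-W» «THE WEIGHT JETS OF THE
# CANONICAL CO-FRAME»** (`HOME/b2b-balaban-beta-d1-p2/K-ASSEMBLY-SPEC-v2.md` v2.5 §3 (T3), owner ruling ρ-g6-12 (1), journal l.23228), PART 2 — ON EVERY
# FINE TORUS `Site 4 s`: the jets of the gradient `D̂_U`, of the covariant Laplacian `L̂_U = D̂_U*D̂_U` and of the CO-FRAME FACTOR `M̂(U) = L̂_U D̂_U*` as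
# EXPLICIT FINITE MATRICES over `TorusHodgeWeight.Dhat` ∕ `PeriodisedProjector.Lhat`; for ANY basis matrix `N` the CO-FRAME JETS `T• = Nᵀ M̂•`
# (`T₀ = NᵀL̂D̂ᵀ`), the GRAM JETS `G• = Nᵀ(L̂²)•N` (`G₀ = NᵀL̂L̂N`) and the INVERSE JETS `A•` of `A(U) = 2•G(U)⁻¹` — EXACTLY the free slots
# `T₀ Tₛ Tₜ Tₛₜ`, `A₀ Aₛ Aₜ Aₛₜ` of K-TA4G (R2) `GramWeightJetsMixed.hessT_gramTransfer_jets` (p240739) — with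
# **`hessT_Ajet : hessT A₀⁻¹ Aₛ Aₜ Aₛₜ = −hessT G₀⁻¹ Gₛ Gₜ Gₛₜ`** (the `A`-term of `hessT_gram_split_jets` IS minus the bi-Laplacian Gram term) and the junction
# `Tjet₀ N (e₁ (m+1) p) = TorusZerothJunction`'s `NᵀL̂D̂ₛᵀ`, `Ajet₀ N = 2•(NᵀL̂L̂N)⁻¹`

HONEST DEPENDENCY (cell records, verbatim): «continuum YM on T⁴ ⇐ BetaPertH ∧ nine spine estimates (0/9 proved); BetaPertH ⇐ (D1) ∧ (D4) ∧
CAP+tail; G-an2-4 gates asym, D1 and NE2/3/4.»  HONEST FRAMING (cell contract, verbatim): «discharging `BetaPertH` makes Bałaban's UV stability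
UNCONDITIONAL — a real constructive-QFT result; it is NOT the continuum limit and NOT the Clay problem.»  THIS MODULE DISCHARGES NOTHING of (K),
of D1 or of the wall: [our object] data definitions (explicit finite matrices, asserting nothing) and [folklore] finite matrix algebra over
gan24-leaf-06-g31's `TorusHodgeWeight.Dhat` ∕ `DhatS`, the road owner's `PeriodisedProjector.Lhat` and `TorusZerothJunction`, an4's `periodise₂` dictionary
(`periodise₂_kdelta`, `periodise₂_eq_tsum_of_rep`) and this lineage's TA4 `MixedVarPackedHess.hessT`, all BY NAME.  THE CONVENTION of PART 1
(`CovariantLaplacianJets`: colour-stripped jets in the plane model, `Cᵀ = −C`, `C² = −1`; every derivative of `D_U` at one bond is the same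
shift table; `(D*)₁ = −Ḋᵀ`, `(D*)₂ = +Ḋᵀ`; (first × first) monomials with a transposed left factor carry `−1`) fixes every sign below; it is stated,
not assumed.  No `def … : Prop`, nothing cited, no wall binder instantiated, 0 sorry.  0∕4 binders of row D1; (K) NOT closed; NOT D1, NOT BetaPertH,
NOT continuum, NOT Clay.

ABSOLUTE RULE (cell charter, verbatim): «No internally-minted statement may enter as a cited fact. Every hypothesis is either kernel-proved in this
package or a verbatim quotation of a PUBLISHED theorem with page reference. The manuscript(s) under audit are NOT citable for their own disputed
steps — they are the thing under adjudication; programme-internal (2001/route/tribunal) claims are never citable.»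

CONTENT (fine torus `Site 4 s`, bonds `β := Site 4 s × Fin 4`, `tip s b := b.1 + siteOf 4 s (unitVec b.2)`, `D̂ := Dhat 4 s`, `L̂ := Lhat s`; the `ℤ⁴` ↔ torus
dictionary `Djet = (periodised array of PART 1's djF)` etc. is PART 3, for TB5's limit socket — NOT here):
§1 `periodise₂_kdelta_shift`, **`Dhat_apply_eq`** (`D̂ (x,κ) z = [z = x + ē_κ] − [z = x]`); [our object] `tip`, the torus first jet `Djet s b = E_{b, tip b}`
(by THE CONVENTION also the pure second ∕ same-bond mixed jet of `D̂_U`); `D̂ᵀÊ`, `ÊᵀD̂`, `ÊᵀÊ′` in closed form, `transpose_Djet_mul_Djet_of_ne`.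
§2 [our object] `Ljet s b := D̂ᵀÊ − ÊᵀD̂` (`Ljet_apply` = torus ghost current), `Ljet₂ s b := ÊᵀD̂ + D̂ᵀÊ − 2•ÊᵀÊ` (`Ljet₂_apply` = minus the hop),
`Ljet₁₁ s b b′ := [b = b′]•Ljet₂` (**`Ljet₁₁_eq_jets`** `= [b=b′]•(ÊᵀD̂ + D̂ᵀÊ) − (ÊᵀÊ′ + Ê′ᵀÊ)`); parity `(Ljet)ᵀ = −Ljet`, `(Ljet₂)ᵀ = Ljet₂`, `(Ljet₁₁)ᵀ = Ljet₁₁`.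
§3 [our object] `Mjet₀ := L̂D̂ᵀ`, `Mjet₁ b := Ljet b·D̂ᵀ − L̂·Êᵀ`, `Mjet₁₁ b b′ := Ljet₁₁·D̂ᵀ − (Ljet b·Ê′ᵀ + Ljet b′·Êᵀ) + [b=b′]•L̂·Êᵀ`.
§4 for `N : Matrix (Site 4 s) ρ ℝ`, `e : ν → β` (road: `e = e₁ (m+1) p`): [our object] `Tjet₀∕Tjet₁∕Tjet₁₁ := (Nᵀ·Mjet•).submatrix id e`; `Gjet₀ := NᵀL̂L̂N`,
`Gjet₁ := Nᵀ(Ljet·L̂ + L̂·Ljet)N`, `Gjet₁₁`; `(Gjet₁)ᵀ = −Gjet₁` ⇒ **`trace_inv_mul_Gjet₁ = 0`** (no first-order Gram tadpole); `Ajet₀ := 2•Gjet₀⁻¹`, `Ajet₁`, `Ajet₁₁`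
(`2•` the inverse jets).  §5 [folklore] `hessT_smul`, **`hessT_inv_jets`**, `inv_Ajet₀`, **`hessT_Ajet`**.  §6 THE JUNCTION with `TorusZerothJunction` (p240639):
**`Tjet₀_eq_coframe : Tjet₀ ((m+1)p) N (e₁ (m+1) p) = Nᵀ * Lhat ((m+1)p) * (DhatS m p)ᵀ`**, `Tjet₁_eq_coframe`, `Ajet₀_eq_weightA` (`rfl`), `isUnit_det_Gjet₀` and
`hessT_Ajet_road` for a basis `N` of `ker Ŝ` (`TorusGaugeWeight.isUnit_det_gram` BY NAME).  NOT HERE: PART 3, TB4-tables (T1), (T2-kin), TB5.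
Provenance: D1 formalisation swarm, unit `b2b-balaban-beta-d1-formalise-leaf-03` (gen 9), claim «TB4-W» journal l.23490, 2026-08-21.
-/

noncomputable section

namespace Summit.QuantumFields.BalabanUV.Beta.D1BFx.TorusCoframeJets

open Matrix
open scoped BigOperators
open Literature.MathematicalPhysics.QuantumFieldTheory.Balaban1983to89
open Literature.MathematicalPhysics.QuantumFieldTheory.Balaban1983to89.Beta
open AffineAveraging (unitVec)
open Summit.QuantumFields.BalabanUV.Beta.D1BFx.MixedVarPackedHess (hessT)
open Summit.QuantumFields.BalabanUV.Beta.D1BFx.StencilKernels (dzKer)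
open Summit.QuantumFields.BalabanUV.Beta.D1BFx.PeriodicArrays (imageShift_sub)
open Summit.QuantumFields.BalabanUV.Beta.D1BFx.PeriodisedProjector (Lhat Shat)
open Summit.QuantumFields.BalabanUV.Beta.D1BFx.TorusGaugeWeight (Lhat_transpose)
open Summit.QuantumFields.BalabanUV.Beta.D1BFx.TorusHodgeWeight (Dhat Dhat_apply DhatS DhatS_transpose_mul_DhatS)
open Summit.QuantumFields.BalabanUV.Beta.D1BFx.SortedEmbedding (e₁)

variable (s : ℕ) [NeZero s]
/-! ## §1 The closed form of `D̂` and the torus first jet `Ê_b` of the covariant gradient -/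

/-- [folklore] Periodisation of a SHIFTED Kronecker kernel: `(δ(· + v, ·))^ x z = [z = x + siteOf v]` — representative independence of an4's
`periodise₂` in the column variable for the translation-invariant `kdelta`, then `periodise₂_kdelta`. -/
theorem periodise₂_kdelta_shift {d : ℕ} (v : Fin d → ℤ) (x z : Site d s) :
    periodise₂ s (fun p q : Fin d → ℤ => kdelta (p + v) q) x z = if z = x + siteOf d s v then (1 : ℝ) else 0 := by
  have hq : siteOf d s (windowMap d s z - v) = z - siteOf d s v := by
    rw [sub_eq_add_neg, siteOf_add, siteOf_neg, siteOf_windowMap, ← sub_eq_add_neg]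
  have h1 : periodise₂ s (fun p q : Fin d → ℤ => kdelta (p + v) q) x z
      = ∑' n, kdelta (windowMap d s x) (imageShift s (windowMap d s z - v) n) := by
    unfold periodise₂
    refine tsum_congr fun n => ?_
    rw [← imageShift_sub]
    simp only [kdelta, eq_sub_iff_add_eq]
  rw [h1, ← periodise₂_eq_tsum_of_rep (isPeriodic₂_kdelta s) (fun p => (summable_abs_kdelta p).of_abs) (siteOf_windowMap d s x) hq,
    periodise₂_kdelta]
  by_cases h : z = x + siteOf d s v
  · rw [if_pos h, if_pos (by rw [h, add_sub_cancel_right])]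
  · rw [if_neg h, if_neg (fun h' => h (by rw [h', sub_add_cancel]))]

/-- [folklore] **CLOSED FORM OF THE FINE-TORUS GRADIENT**: `D̂ (x,κ) z = [z = x + ē_κ] − [z = x]`, `ē_κ := siteOf 4 s (unitVec κ)` (all `s ≥ 1`). -/
theorem Dhat_apply_eq (x : Site 4 s) (κ : Fin 4) (z : Site 4 s) :
    Dhat 4 s (x, κ) z = (if z = x + siteOf 4 s (unitVec κ) then (1 : ℝ) else 0) - (if z = x then 1 else 0) := by
  rw [Dhat_apply]
  have e : dzKer (d := 4) κ = (fun p q : Fin 4 → ℤ => kdelta (p + unitVec κ) q) + (fun p q : Fin 4 → ℤ => (-1) * kdelta p q) := by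
    funext p q
    show (if q = p + unitVec κ then (1 : ℝ) else 0) - (if q = p then 1 else 0)
      = (if p + unitVec κ = q then (1 : ℝ) else 0) + (-1) * (if p = q then 1 else 0)
    rw [if_congr eq_comm rfl rfl, if_congr (@eq_comm _ q p) rfl rfl]
    ring
  have hrow1 : ∀ p : Fin 4 → ℤ, Summable (fun q => kdelta (d := 4) (p + unitVec κ) q) := fun p => (summable_abs_kdelta (p + unitVec κ)).of_abs
  have hrow2 : ∀ p : Fin 4 → ℤ, Summable (fun q => (-1) * kdelta (d := 4) p q) := fun p => ((summable_abs_kdelta p).of_abs).mul_left _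
  rw [e, periodise₂_add hrow1 hrow2, periodise₂_const_mul, periodise₂_kdelta_shift, periodise₂_kdelta, if_congr (@eq_comm _ x z) rfl rfl]
  ring

/-- [folklore] `if P ∧ Q` as a product of indicators. -/
theorem ite_and_eq_mul (P Q : Prop) [Decidable P] [Decidable Q] :
    (if P ∧ Q then (1 : ℝ) else 0) = (if P then (1 : ℝ) else 0) * (if Q then 1 else 0) := by
  by_cases hP : P <;> by_cases hQ : Q <;> simp [hP, hQ]

/-- [our object] The FAR ENDPOINT of the torus bond `b = (x̄, κ)`: `x̄ + ē_κ`. -/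
def tip (b : Site 4 s × Fin 4) : Site 4 s := b.1 + siteOf 4 s (unitVec b.2)

/-- [our object] **THE TORUS FIRST JET `Ê_b` OF THE COVARIANT GRADIENT** along the torus bond `b`: the single-entry matrix `E_{b, tip b}`
(rows = torus bonds, columns = torus sites).  By THE CONVENTION also the pure second jet and the same-bond mixed jet of `D̂_U`; cross-bond mixed
jets of `D̂_U` are `0`.  A definition; asserts nothing. -/
def Djet (b : Site 4 s × Fin 4) : Matrix (Site 4 s × Fin 4) (Site 4 s) ℝ := Matrix.of fun i z => if i = b ∧ z = tip s b then 1 else 0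

variable (b b' : Site 4 s × Fin 4)

omit [NeZero s] in
/-- [our object] Unfolding `Djet`. -/
@[simp] theorem Djet_apply (i : Site 4 s × Fin 4) (z : Site 4 s) : Djet s b i z = if i = b ∧ z = tip s b then (1 : ℝ) else 0 := rfl

/-- [folklore] `D̂` at the bond `b` in terms of `tip`: `D̂ b z = [z = tip b] − [z = b.1]`. -/
theorem Dhat_bond_apply (z : Site 4 s) : Dhat 4 s b z = (if z = tip s b then (1 : ℝ) else 0) - (if z = b.1 then 1 else 0) := by
  obtain ⟨x, κ⟩ := b
  exact Dhat_apply_eq s x κ z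

/-- [folklore] **`D̂ᵀÊ` IN CLOSED FORM**: `(D̂ᵀ·Ê_b) x z = [z = tip b]·([x = tip b] − [x = b.1])`. -/
theorem transpose_Dhat_mul_Djet_apply (x z : Site 4 s) : ((Dhat 4 s)ᵀ * Djet s b) x z
    = (if z = tip s b then (1 : ℝ) else 0) * ((if x = tip s b then (1 : ℝ) else 0) - (if x = b.1 then 1 else 0)) := by
  rw [Matrix.mul_apply, Finset.sum_eq_single b]
  · rw [Matrix.transpose_apply, Djet_apply, Dhat_bond_apply]
    simp only [true_and]
    ring
  · intro i _ hi
    rw [Djet_apply, if_neg (fun h => hi h.1), mul_zero]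
  · intro h; exact absurd (Finset.mem_univ b) h

/-- [folklore] **`ÊᵀD̂` IN CLOSED FORM**: `(Ê_bᵀ·D̂) x z = [x = tip b]·([z = tip b] − [z = b.1])`. -/
theorem transpose_Djet_mul_Dhat_apply (x z : Site 4 s) : ((Djet s b)ᵀ * Dhat 4 s) x z
    = (if x = tip s b then (1 : ℝ) else 0) * ((if z = tip s b then (1 : ℝ) else 0) - (if z = b.1 then 1 else 0)) := by
  rw [Matrix.mul_apply, Finset.sum_eq_single b]
  · rw [Matrix.transpose_apply, Djet_apply, Dhat_bond_apply]
    simp only [true_and]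
  · intro i _ hi
    rw [Matrix.transpose_apply, Djet_apply, if_neg (fun h => hi h.1), zero_mul]
  · intro h; exact absurd (Finset.mem_univ b) h

/-- [folklore] **`ÊᵀÊ′` IN CLOSED FORM**: `(Ê_bᵀ·Ê_{b′}) x z = [b = b′]·[x = tip b]·[z = tip b′]`. -/
theorem transpose_Djet_mul_Djet_apply (x z : Site 4 s) : ((Djet s b)ᵀ * Djet s b') x z
    = (if b = b' then (1 : ℝ) else 0) * (if x = tip s b then (1 : ℝ) else 0) * (if z = tip s b' then 1 else 0) := by
  rw [Matrix.mul_apply, Finset.sum_eq_single b]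
  · rw [Matrix.transpose_apply, Djet_apply, Djet_apply]
    simp only [true_and]
    rw [ite_and_eq_mul]
    ring
  · intro i _ hi
    rw [Matrix.transpose_apply, Djet_apply, if_neg (fun h => hi h.1), zero_mul]
  · intro h; exact absurd (Finset.mem_univ b) h

/-- [folklore] **CROSS-BOND PRODUCTS VANISH**: `Ê_bᵀ·Ê_{b′} = 0` for `b ≠ b′`. -/
theorem transpose_Djet_mul_Djet_of_ne (h : b ≠ b') : (Djet s b)ᵀ * Djet s b' = 0 := by
  ext x z
  rw [transpose_Djet_mul_Djet_apply, if_neg h, zero_mul, zero_mul, Matrix.zero_apply]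

/-! ## §2 The jets of the covariant Laplacian `L̂_U = D̂_U*D̂_U` -/

/-- [our object] **THE TORUS FIRST JET OF `L̂_U`** along `b`: `D̂ᵀÊ_b − Ê_bᵀD̂` (THE CONVENTION: `(D*)₁ = −Êᵀ`).  A definition. -/
def Ljet : Matrix (Site 4 s) (Site 4 s) ℝ := (Dhat 4 s)ᵀ * Djet s b - (Djet s b)ᵀ * Dhat 4 s

/-- [folklore] **CLOSED FORM** (the torus ghost current): `Ljet s b x z = [x = tip b][z = b.1] − [x = b.1][z = tip b]`. -/
theorem Ljet_apply (x z : Site 4 s) : Ljet s b x z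
    = (if x = tip s b then (1 : ℝ) else 0) * (if z = b.1 then 1 else 0) - (if x = b.1 then (1 : ℝ) else 0) * (if z = tip s b then 1 else 0) := by
  rw [Ljet, Matrix.sub_apply, transpose_Dhat_mul_Djet_apply, transpose_Djet_mul_Dhat_apply]
  ring

/-- [folklore] PARITY TYPE: the first jet is ANTISYMMETRIC. -/
theorem transpose_Ljet : (Ljet s b)ᵀ = -Ljet s b := by
  rw [Ljet, Matrix.transpose_sub, Matrix.transpose_mul, Matrix.transpose_mul, Matrix.transpose_transpose, Matrix.transpose_transpose, neg_sub]

/-- [our object] **THE TORUS PURE SECOND JET OF `L̂_U`** along `b`: `Ê_bᵀD̂ + D̂ᵀÊ_b − 2•Ê_bᵀÊ_b` (THE CONVENTION: `D₂ = Ê`, `(D*)₂ = +Êᵀ`,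
the two (first × first) monomials carry `−1`).  A definition. -/
def Ljet₂ : Matrix (Site 4 s) (Site 4 s) ℝ := (Djet s b)ᵀ * Dhat 4 s + (Dhat 4 s)ᵀ * Djet s b - (2 : ℝ) • ((Djet s b)ᵀ * Djet s b)

/-- [folklore] **CLOSED FORM** (minus the symmetric hop across the bond): `Ljet₂ s b x z = −([x = b.1][z = tip b] + [x = tip b][z = b.1])`. -/
theorem Ljet₂_apply (x z : Site 4 s) : Ljet₂ s b x z
    = -((if x = b.1 then (1 : ℝ) else 0) * (if z = tip s b then 1 else 0) + (if x = tip s b then (1 : ℝ) else 0) * (if z = b.1 then 1 else 0)) := by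
  rw [Ljet₂, Matrix.sub_apply, Matrix.add_apply, Matrix.smul_apply, smul_eq_mul, transpose_Djet_mul_Dhat_apply, transpose_Dhat_mul_Djet_apply,
    transpose_Djet_mul_Djet_apply, if_pos rfl]
  ring

/-- [folklore] PARITY TYPE: the pure second jet is SYMMETRIC. -/
theorem transpose_Ljet₂ : (Ljet₂ s b)ᵀ = Ljet₂ s b := by
  rw [Ljet₂, Matrix.transpose_sub, Matrix.transpose_add, Matrix.transpose_smul, Matrix.transpose_mul, Matrix.transpose_mul, Matrix.transpose_mul,
    Matrix.transpose_transpose, Matrix.transpose_transpose, add_comm]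

/-- [our object] **THE TORUS MIXED SECOND JET `∂ₛ∂ₜL̂_U`** along two torus bonds: `[b = b′]•Ljet₂ s b` (cross-bond mixed jets VANISH).  A definition;
`Ljet₁₁_eq_jets`. -/
def Ljet₁₁ : Matrix (Site 4 s) (Site 4 s) ℝ := if b = b' then Ljet₂ s b else 0

/-- [folklore] On the diagonal the mixed jet is the pure second jet. -/
theorem Ljet₁₁_self : Ljet₁₁ s b b = Ljet₂ s b := if_pos rfl

/-- [folklore] Cross-bond mixed jets vanish. -/
theorem Ljet₁₁_of_ne (h : b ≠ b') : Ljet₁₁ s b b' = 0 := if_neg h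

/-- [folklore] **THE MIXED-JET DERIVATION `Ljet₁₁ = [b = b′]•(ÊᵀD̂ + D̂ᵀÊ) − (ÊᵀÊ′ + Ê′ᵀÊ)`** (`D_st = [b=b′]•Ê`, `(D*)_st = [b=b′]•Êᵀ`;
`(D*)_sD_t + (D*)_tD_s = −(ÊᵀÊ′ + Ê′ᵀÊ)`, which vanishes off the diagonal by `transpose_Djet_mul_Djet_of_ne`). -/
theorem Ljet₁₁_eq_jets : Ljet₁₁ s b b'
    = (if b = b' then (Djet s b)ᵀ * Dhat 4 s + (Dhat 4 s)ᵀ * Djet s b else 0) - ((Djet s b)ᵀ * Djet s b' + (Djet s b')ᵀ * Djet s b) := by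
  by_cases h : b = b'
  · subst h
    rw [Ljet₁₁_self, if_pos rfl, Ljet₂, two_smul]
  · rw [Ljet₁₁_of_ne s b b' h, if_neg h, transpose_Djet_mul_Djet_of_ne s b b' h, transpose_Djet_mul_Djet_of_ne s b' b (Ne.symm h), add_zero, sub_zero]

/-- [folklore] The mixed jet is symmetric in the two bonds. -/
theorem Ljet₁₁_comm : Ljet₁₁ s b' b = Ljet₁₁ s b b' := by
  by_cases h : b = b'
  · subst h; rfl
  · rw [Ljet₁₁_of_ne s b b' h, Ljet₁₁_of_ne s b' b (Ne.symm h)]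

/-- [folklore] PARITY TYPE: the mixed jet is SYMMETRIC. -/
theorem transpose_Ljet₁₁ : (Ljet₁₁ s b b')ᵀ = Ljet₁₁ s b b' := by
  by_cases h : b = b'
  · subst h; rw [Ljet₁₁_self, transpose_Ljet₂]
  · rw [Ljet₁₁_of_ne s b b' h, Matrix.transpose_zero]

/-! ## §3 The jets of the co-frame factor `M̂(U) = L̂_U D̂_U*` (site rows, bond columns) -/

/-- [our object] **`M̂₀ = L̂·D̂ᵀ`**.  A definition. -/
def Mjet₀ : Matrix (Site 4 s) (Site 4 s × Fin 4) ℝ := Lhat s * (Dhat 4 s)ᵀ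

/-- [our object] **`M̂_s = Ljet·D̂ᵀ − L̂·Êᵀ`** (`M₁ = L₁(D*)₀ + L₀(D*)₁`, `(D*)₁ = −Êᵀ`).  A definition. -/
def Mjet₁ : Matrix (Site 4 s) (Site 4 s × Fin 4) ℝ := Ljet s b * (Dhat 4 s)ᵀ - Lhat s * (Djet s b)ᵀ

/-- [our object] **`M̂_st = Ljet₁₁·D̂ᵀ − (Ljet b·Ê′ᵀ + Ljet b′·Êᵀ) + [b = b′]•L̂·Êᵀ`** (`M_st = L_st(D*)₀ + L_s(D*)_t + L_t(D*)_s + L₀(D*)_st`).  A definition;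
the pure second jet is the diagonal `Mjet₁₁ s b b`. -/
def Mjet₁₁ : Matrix (Site 4 s) (Site 4 s × Fin 4) ℝ :=
  Ljet₁₁ s b b' * (Dhat 4 s)ᵀ - (Ljet s b * (Djet s b')ᵀ + Ljet s b' * (Djet s b)ᵀ) + (if b = b' then Lhat s * (Djet s b)ᵀ else 0)

/-! ## §4 The co-frame jets `T•`, the Gram jets `G•` and the inverse jets `A•` over a basis matrix `N` -/

section Basis
variable {ρ ν : Type*} [Fintype ρ] [DecidableEq ρ] (N : Matrix (Site 4 s) ρ ℝ) (e : ν → Site 4 s × Fin 4)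

/-- [our object] **`T₀ = (Nᵀ·L̂·D̂ᵀ)` with columns re-indexed by `e`** (on the road `e = e₁ (m+1) p`: `= NᵀL̂D̂ₛᵀ`, §6).  A definition. -/
def Tjet₀ : Matrix ρ ν ℝ := (Nᵀ * Mjet₀ s).submatrix id e

/-- [our object] **`T_s = (Nᵀ·M̂_s)` re-indexed.**  A definition. -/
def Tjet₁ : Matrix ρ ν ℝ := (Nᵀ * Mjet₁ s b).submatrix id e

/-- [our object] **`T_st = (Nᵀ·M̂_st)` re-indexed** (pure second jets = the diagonal `b = b′`).  A definition. -/
def Tjet₁₁ : Matrix ρ ν ℝ := (Nᵀ * Mjet₁₁ s b b').submatrix id e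

/-- [our object] **THE BI-LAPLACIAN GRAM `G₀ = Nᵀ·L̂·L̂·N`** (`A₀ = 2•G₀⁻¹`).  A definition. -/
def Gjet₀ : Matrix ρ ρ ℝ := Nᵀ * Lhat s * Lhat s * N

/-- [our object] **`G_s = Nᵀ·(Ljet·L̂ + L̂·Ljet)·N`.**  A definition. -/
def Gjet₁ : Matrix ρ ρ ℝ := Nᵀ * (Ljet s b * Lhat s + Lhat s * Ljet s b) * N

/-- [our object] **`G_st = Nᵀ·(Ljet₁₁·L̂ + Ljet b·Ljet b′ + Ljet b′·Ljet b + L̂·Ljet₁₁)·N`.**  A definition. -/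
def Gjet₁₁ : Matrix ρ ρ ℝ := Nᵀ * (Ljet₁₁ s b b' * Lhat s + Ljet s b * Ljet s b' + Ljet s b' * Ljet s b + Lhat s * Ljet₁₁ s b b') * N

/-- [our object] **`A₀ = 2•G₀⁻¹`.**  A definition. -/
def Ajet₀ : Matrix ρ ρ ℝ := (2 : ℝ) • (Gjet₀ s N)⁻¹

/-- [our object] **`A_s = −2•G₀⁻¹G_sG₀⁻¹`** (first inverse jet).  A definition. -/
def Ajet₁ : Matrix ρ ρ ℝ := -((2 : ℝ) • ((Gjet₀ s N)⁻¹ * Gjet₁ s b N * (Gjet₀ s N)⁻¹))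

/-- [our object] **`A_st = 2•(−G₀⁻¹G_stG₀⁻¹ + G₀⁻¹G_sG₀⁻¹G_tG₀⁻¹ + G₀⁻¹G_tG₀⁻¹G_sG₀⁻¹)`** (mixed inverse jet).  A definition. -/
def Ajet₁₁ : Matrix ρ ρ ℝ := (2 : ℝ) • (-((Gjet₀ s N)⁻¹ * Gjet₁₁ s b b' N * (Gjet₀ s N)⁻¹)
    + (Gjet₀ s N)⁻¹ * Gjet₁ s b N * (Gjet₀ s N)⁻¹ * Gjet₁ s b' N * (Gjet₀ s N)⁻¹
    + (Gjet₀ s N)⁻¹ * Gjet₁ s b' N * (Gjet₀ s N)⁻¹ * Gjet₁ s b N * (Gjet₀ s N)⁻¹)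

omit [Fintype ρ] [DecidableEq ρ] in
/-- [folklore] `G₀` is symmetric (`L̂ᵀ = L̂`). -/
theorem transpose_Gjet₀ : (Gjet₀ s N)ᵀ = Gjet₀ s N := by
  rw [Gjet₀, Matrix.transpose_mul, Matrix.transpose_mul, Matrix.transpose_mul, Matrix.transpose_transpose, Lhat_transpose]
  simp only [Matrix.mul_assoc]

omit [Fintype ρ] [DecidableEq ρ] in
/-- [folklore] PARITY TYPE: **THE FIRST GRAM JET IS ODD**, `(G_s)ᵀ = −G_s`. -/
theorem transpose_Gjet₁ : (Gjet₁ s b N)ᵀ = -Gjet₁ s b N := by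
  rw [Gjet₁, Matrix.transpose_mul, Matrix.transpose_mul, Matrix.transpose_transpose, Matrix.transpose_add, Matrix.transpose_mul,
    Matrix.transpose_mul, transpose_Ljet, Lhat_transpose]
  rw [show Lhat s * -Ljet s b + -Ljet s b * Lhat s = -(Ljet s b * Lhat s + Lhat s * Ljet s b) by rw [Matrix.mul_neg, Matrix.neg_mul]; abel,
    Matrix.neg_mul, Matrix.mul_neg, Matrix.mul_assoc]

omit [DecidableEq ρ] in
/-- [folklore] The trace of (symmetric)·(antisymmetric) vanishes. -/
theorem trace_mul_eq_zero_of_symm_of_antisymm {S A : Matrix ρ ρ ℝ} (hS : Sᵀ = S) (hA : Aᵀ = -A) : (S * A).trace = 0 := by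
  have h : (S * A).trace = -(S * A).trace := by
    conv_lhs => rw [← Matrix.trace_transpose, Matrix.transpose_mul, hS, hA, Matrix.neg_mul, Matrix.trace_neg, Matrix.trace_mul_comm]
  linarith

/-- [folklore] **NO FIRST-ORDER TADPOLE IN THE GRAM TERM**: `trace (G₀⁻¹·G_s) = 0` (`G₀⁻¹` symmetric, `G_s` antisymmetric). -/
theorem trace_inv_mul_Gjet₁ : ((Gjet₀ s N)⁻¹ * Gjet₁ s b N).trace = 0 :=
  trace_mul_eq_zero_of_symm_of_antisymm (by rw [Matrix.transpose_nonsing_inv, transpose_Gjet₀]) (transpose_Gjet₁ s b N)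
end Basis

/-! ## §5 `hessT` of the inverse jets -/

section Hess
variable {ι : Type*} [Fintype ι] [DecidableEq ι]

omit [DecidableEq ι] in
/-- [folklore] `hessT` is invariant under the rescaling `(L, V, V′, W) ↦ (c⁻¹•L, c•V, c•V′, c•W)`, `c ≠ 0`. -/
theorem hessT_smul {c : ℝ} (hc : c ≠ 0) (L V V' W : Matrix ι ι ℝ) : hessT (c⁻¹ • L) (c • V) (c • V') (c • W) = hessT L V V' W := by
  unfold hessT
  simp only [Matrix.smul_mul, Matrix.mul_smul, Matrix.trace_smul, smul_eq_mul]
  field_simp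

/-- [folklore] **`hessT` OF THE INVERSE JETS** (polarised form of `SliceTransferJetsAlgebra.secondVar_inv_jets`): with `S(u) = G(u)⁻¹`,
`S_s = −G₀⁻¹G_sG₀⁻¹`, `S_st = −G₀⁻¹G_stG₀⁻¹ + G₀⁻¹G_sG₀⁻¹G_tG₀⁻¹ + G₀⁻¹G_tG₀⁻¹G_sG₀⁻¹`, `hessT (S₀⁻¹ = G₀) S_s S_t S_st = −hessT G₀⁻¹ G_s G_t G_st`. -/
theorem hessT_inv_jets (G₀ Gs Gt Gst : Matrix ι ι ℝ) (hG : IsUnit G₀.det) :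
    hessT G₀ (-(G₀⁻¹ * Gs * G₀⁻¹)) (-(G₀⁻¹ * Gt * G₀⁻¹))
        (-(G₀⁻¹ * Gst * G₀⁻¹) + G₀⁻¹ * Gs * G₀⁻¹ * Gt * G₀⁻¹ + G₀⁻¹ * Gt * G₀⁻¹ * Gs * G₀⁻¹)
      = -hessT G₀⁻¹ Gs Gt Gst := by
  have hGS : G₀ * G₀⁻¹ = 1 := Matrix.mul_nonsing_inv _ hG
  have red : ∀ X : Matrix ι ι ℝ, G₀ * (G₀⁻¹ * X) = X := fun X => by rw [← Matrix.mul_assoc, hGS, Matrix.one_mul]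
  unfold hessT
  have e1 : G₀ * (-(G₀⁻¹ * Gst * G₀⁻¹) + G₀⁻¹ * Gs * G₀⁻¹ * Gt * G₀⁻¹ + G₀⁻¹ * Gt * G₀⁻¹ * Gs * G₀⁻¹)
      = -(Gst * G₀⁻¹) + Gs * G₀⁻¹ * Gt * G₀⁻¹ + Gt * G₀⁻¹ * Gs * G₀⁻¹ := by
    rw [Matrix.mul_add, Matrix.mul_add, Matrix.mul_neg]
    simp only [Matrix.mul_assoc] at red ⊢
    rw [red, red, red]
  have e2 : G₀ * -(G₀⁻¹ * Gs * G₀⁻¹) * (G₀ * -(G₀⁻¹ * Gt * G₀⁻¹)) = Gs * G₀⁻¹ * Gt * G₀⁻¹ := by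
    rw [Matrix.mul_neg, Matrix.mul_neg, neg_mul_neg]
    simp only [Matrix.mul_assoc] at red ⊢
    rw [red, red]
  rw [e1, e2, Matrix.trace_add, Matrix.trace_add, Matrix.trace_neg]
  have t1 : (Gst * G₀⁻¹).trace = (G₀⁻¹ * Gst).trace := Matrix.trace_mul_comm _ _
  have t2 : (Gt * G₀⁻¹ * Gs * G₀⁻¹).trace = (G₀⁻¹ * Gs * (G₀⁻¹ * Gt)).trace := by
    rw [show Gt * G₀⁻¹ * Gs * G₀⁻¹ = (Gt * (G₀⁻¹ * Gs)) * G₀⁻¹ by simp only [Matrix.mul_assoc], Matrix.trace_mul_comm,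
      show G₀⁻¹ * (Gt * (G₀⁻¹ * Gs)) = (G₀⁻¹ * Gt) * (G₀⁻¹ * Gs) by simp only [Matrix.mul_assoc], Matrix.trace_mul_comm]
  have t3 : (Gs * G₀⁻¹ * Gt * G₀⁻¹).trace = (G₀⁻¹ * Gs * (G₀⁻¹ * Gt)).trace := by
    rw [show Gs * G₀⁻¹ * Gt * G₀⁻¹ = (Gs * (G₀⁻¹ * Gt)) * G₀⁻¹ by simp only [Matrix.mul_assoc], Matrix.trace_mul_comm,
      show G₀⁻¹ * (Gs * (G₀⁻¹ * Gt)) = G₀⁻¹ * Gs * (G₀⁻¹ * Gt) by simp only [Matrix.mul_assoc]]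
  rw [t1, t2, t3]
  ring

variable {ρ : Type*} [Fintype ρ] [DecidableEq ρ] (N : Matrix (Site 4 s) ρ ℝ)

/-- [folklore] `A₀⁻¹ = ½•G₀` (for `det G₀ ≠ 0`). -/
theorem inv_Ajet₀ (hG : IsUnit (Gjet₀ s N).det) : (Ajet₀ s N)⁻¹ = (2 : ℝ)⁻¹ • Gjet₀ s N := by
  refine Matrix.inv_eq_left_inv ?_
  rw [Ajet₀, Matrix.smul_mul, Matrix.mul_smul, smul_smul, Matrix.mul_nonsing_inv _ hG]
  norm_num

/-- [folklore] **THE `A`-TERM IS MINUS THE BI-LAPLACIAN GRAM TERM**: `hessT A₀⁻¹ A_s A_t A_st = −hessT G₀⁻¹ G_s G_t G_st` — the `hessT A₀⁻¹ Aₛ Aₜ Aₛₜ`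
of `GramWeightJetsMixed.hessT_gram_split_jets` at the inverse jets of `A(U) = 2•(NᵀL̂_U²N)⁻¹` (owner's count K-ASSEMBLY-SPEC v2.1: `h[Φ] = 2h[τ′W] − h[NᵀΔ_U²N]`). -/
theorem hessT_Ajet (hG : IsUnit (Gjet₀ s N).det) :
    hessT (Ajet₀ s N)⁻¹ (Ajet₁ s b N) (Ajet₁ s b' N) (Ajet₁₁ s b b' N)
      = -hessT (Gjet₀ s N)⁻¹ (Gjet₁ s b N) (Gjet₁ s b' N) (Gjet₁₁ s b b' N) := by
  rw [inv_Ajet₀ s N hG, Ajet₁, Ajet₁, Ajet₁₁, ← smul_neg, ← smul_neg, hessT_smul two_ne_zero]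
  exact hessT_inv_jets _ _ _ _ hG
end Hess

/-! ## §6 The junction with `TorusZerothJunction`: `T₀ = NᵀL̂D̂ₛᵀ`, `A₀ = 2•(NᵀL̂L̂N)⁻¹` -/

section Junction
variable (m : ℕ) {a : ℝ} (p : ℕ) [NeZero p] {ρ : Type*} [Fintype ρ] [DecidableEq ρ]

omit [Fintype ρ] [DecidableEq ρ] in
/-- [folklore] Column re-indexing passes through a product: `(A·B).submatrix id e = A·(B.submatrix id e)`. -/
theorem submatrix_id_mul {α β γ δ : Type*} [Fintype β] (A : Matrix α β ℝ) (B : Matrix β γ ℝ) (e : δ → γ) :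
    (A * B).submatrix id e = A * B.submatrix id e := by
  ext i j
  rfl

omit [Fintype ρ] [DecidableEq ρ] in
/-- [folklore] **`Tjet₀` ON THE ROAD IS `TorusZerothJunction`'s `T₀`**: `Tjet₀ ((m+1)p) N (e₁ (m+1) p) = Nᵀ·L̂·D̂ₛᵀ` (`DhatS = D̂.submatrix e₁ id`). -/
theorem Tjet₀_eq_coframe (N : Matrix (Site 4 ((m + 1) * p)) ρ ℝ) :
    Tjet₀ ((m + 1) * p) N (e₁ (m + 1) p) = Nᵀ * Lhat ((m + 1) * p) * (DhatS m p)ᵀ := by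
  rw [Tjet₀, Mjet₀, submatrix_id_mul, submatrix_id_mul, DhatS, Matrix.transpose_submatrix, Matrix.mul_assoc]

omit [Fintype ρ] [DecidableEq ρ] in
/-- [folklore] The first co-frame jet on the road, unfolded: `Tjet₁ = Nᵀ·Ljet·D̂ₛᵀ − Nᵀ·L̂·(Ê.submatrix e₁ id)ᵀ`. -/
theorem Tjet₁_eq_coframe (N : Matrix (Site 4 ((m + 1) * p)) ρ ℝ) (b : Site 4 ((m + 1) * p) × Fin 4) :
    Tjet₁ ((m + 1) * p) b N (e₁ (m + 1) p)
      = Nᵀ * Ljet ((m + 1) * p) b * (DhatS m p)ᵀ - Nᵀ * Lhat ((m + 1) * p) * ((Djet ((m + 1) * p) b).submatrix (e₁ (m + 1) p) id)ᵀ := by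
  rw [Tjet₁, Mjet₁, submatrix_id_mul, Matrix.submatrix_sub, Pi.sub_apply, Pi.sub_apply, submatrix_id_mul, submatrix_id_mul, DhatS,
    Matrix.transpose_submatrix, Matrix.transpose_submatrix, Matrix.mul_sub, Matrix.mul_assoc, Matrix.mul_assoc]

/-- [folklore] **`Ajet₀` IS `TorusZerothJunction`'s `A₀`** (by `rfl`), displayed. -/
theorem Ajet₀_eq_weightA (N : Matrix (Site 4 ((m + 1) * p)) ρ ℝ) :
    Ajet₀ ((m + 1) * p) N = (2 : ℝ) • (Nᵀ * Lhat ((m + 1) * p) * Lhat ((m + 1) * p) * N)⁻¹ := rfl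

/-- [folklore] **`det G₀ ≠ 0`** (`IsUnit` form) for a basis `N` of `ker Ŝ` (`TorusGaugeWeight.isUnit_det_gram`) — the hypothesis of `hessT_Ajet`. -/
theorem isUnit_det_Gjet₀ (ha : 0 < a) {N : Matrix (Site 4 ((m + 1) * p)) ρ ℝ}
    (hN : ∀ lam : Site 4 ((m + 1) * p) → ℝ, Shat m ((m + 1) * p) *ᵥ lam = 0 ↔ ∃ c : ρ → ℝ, lam = N *ᵥ c)
    (hNinj : Function.Injective N.mulVec) : IsUnit (Gjet₀ ((m + 1) * p) N).det :=
  TorusGaugeWeight.isUnit_det_gram ha rfl hN hNinj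

/-- [folklore] **THE `A`-TERM ON THE ROAD**: for a basis `N` of `ker Ŝ`, `hessT A₀⁻¹ A_s A_t A_st = −hessT G₀⁻¹ G_s G_t G_st` unconditionally. -/
theorem hessT_Ajet_road (ha : 0 < a) {N : Matrix (Site 4 ((m + 1) * p)) ρ ℝ}
    (hN : ∀ lam : Site 4 ((m + 1) * p) → ℝ, Shat m ((m + 1) * p) *ᵥ lam = 0 ↔ ∃ c : ρ → ℝ, lam = N *ᵥ c)
    (hNinj : Function.Injective N.mulVec) (b b' : Site 4 ((m + 1) * p) × Fin 4) :
    hessT (Ajet₀ ((m + 1) * p) N)⁻¹ (Ajet₁ ((m + 1) * p) b N) (Ajet₁ ((m + 1) * p) b' N) (Ajet₁₁ ((m + 1) * p) b b' N)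
      = -hessT (Gjet₀ ((m + 1) * p) N)⁻¹ (Gjet₁ ((m + 1) * p) b N) (Gjet₁ ((m + 1) * p) b' N) (Gjet₁₁ ((m + 1) * p) b b' N) :=
  hessT_Ajet _ b b' N (isUnit_det_Gjet₀ m p ha hN hNinj)
end Junction

end Summit.QuantumFields.BalabanUV.Beta.D1BFx.TorusCoframeJets

end
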